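import Summits.AnomalousDissipation.AnomalousDissipation.Theorems.SolenoidalFractalHomogenisationLagrangianRenormalisationStepTailLevels
import Summits.AnomalousDissipation.AnomalousDissipation.Theorems.SolenoidalFractalHomogenisationLagrangianCarrierConstructionRegularLWindowDistortion
import Summits.AnomalousDissipation.AnomalousDissipation.Theorems.SolenoidalFractalHomogenisationLagrangianStepDefs
import Literature.Analysis.FluidPDE.PassiveVectorTensorStreamSeries
import HarnessLib

/-!
# K1L `LagrangianRenormalisationStep` (stmt-AnomalousDissipation-24912), skeleton of record v21 (`onelevel`): the stub `stub_tailL` BY NAME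

**The tail step of the Lagrangian renormalisation cascade, stream form (cell ruling R23-1 (A)).**  For every word design `W` there are a
separation `Λ₁` (any; `0` is used) and a strain-budget ceiling `θs = θs(k, W) > 0` (the ceiling of the K3L distortion tower,
`…RegularLWindowDistortion.flowDeriv_window_distortion_le`) such that for every L-permissible, regular Lagrangian lattice carrier `E` with
design `W` on the K1L template (`N_m² ≤ N_{m+1}`, (T2) `cellVisc_{m+1} (N_{m+1}/N_m)^{1/4} ≤ 1`, (T4) at a budget `θ₀ ≤ θs`) and every `ε > 0`
there is `j₂` beyond which every weak solution `w` of the FULL problem (carrier `E.carrier = Σ_m b_{m+1}`, viscosity `kbar_j`) retains at most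
`ε ‖w₀‖²` more energy than any weak solution `u` of the problem TRUNCATED at level `j` (carrier `partialSum j`, same viscosity), a.e. on `(1/2, 1)`:
`drop w₀ u t ≤ drop w₀ w t + ε ‖w₀‖²`.

Proof (all inputs landed).  (1) Under the ceiling the coarse flows have `‖DX_m‖ ≤ 11/10` on the refresh windows (K3L tower export, p633004).
(2) Hence every Lagrangian level `b_{m+1}(t)` is the weak divergence of an antisymmetric potential of size
`Λ_m = 9 (11/10)² k a_{m+1}/(2π² N_{m+1}²)` and has sup `B_m = (11/10) k a_{m+1}/(2π N_{m+1})` (`…TailLevels`: word potential pushed forward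
along the window's flow).  (3) On the template `Σ_{m ≥ j} Λ_m ≤ C_k kbar_j q^j /((1−q) gain)`, `q = 2^{-1/4}`, and `Σ B_m < ∞` (amplitude decay (A)).
(4) The levelwise data feed `PassiveVectorTensorStreamSeries.stream_of_levels_tail` (tail potential `Σ_{m ≥ j} ψ_m`, dominated interchange),
and the energy-class stability `PassiveVectorTensorStreamStability.ae_integral_norm_sq_le_add_of_stream` (p615321) gives
`∫‖w(t)‖² ≤ ∫‖u(t)‖² + (2η + η²)‖w₀‖²`, `η = 3 Σ_{m≥j}Λ_m/(2 kbar_j) ≤ C q^j → 0`; choose `j₂(ε)`.  The theorem carries the REGISTERED signature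
textually over the shared definitions `LagrangianStep.{VF, IsDatum, FullSol, TSol, drop}` (p610007).

No definitions, no named facts, no sorry; rung-leaf bookkeeping only — route-1 closes rung F-D1.A0 (`…Theses.SolenoidalFractalHomogenisation.Target`),
a frontier FORMAL rung; nothing about Onsager's conjecture or anomalous dissipation is claimed.  Prover seat `ad-k3l-bookkeeping-p1` g3, 2026-08-28.
-/

set_option linter.dupNamespace false

noncomputable section

namespace Summit.AnomalousDissipation.AnomalousDissipation.Theorems.SolenoidalFractalHomogenisation.LagrangianStep

open Literature.Analysis Literature.Analysis.FluidPDE Literature.Analysis.FunctionSpaces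
open MeasureTheory Set Filter Function
open scoped ENNReal NNReal InnerProductSpace

/-- Geometric tails beat any positive threshold: for `0 ≤ q < 1`, `0 ≤ K` and `δ > 0` there is `j₂` with `K q^j ≤ δ` for all `j ≥ j₂`. [folklore] -/
theorem exists_forall_mul_pow_le {q K δ : ℝ} (hq0 : 0 ≤ q) (hq1 : q < 1) (hK : 0 ≤ K) (hδ : 0 < δ) :
    ∃ j₂ : ℕ, ∀ j, j₂ ≤ j → K * q ^ j ≤ δ := by
  obtain ⟨n, hn⟩ := exists_pow_lt_of_lt_one (div_pos hδ (by linarith : (0:ℝ) < K + 1)) hq1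
  refine ⟨n, fun j hj => ?_⟩
  have hqj : q ^ j ≤ q ^ n := pow_le_pow_of_le_one hq0 hq1.le hj
  have h1 : K * q ^ j ≤ (K + 1) * q ^ n := by
    have : 0 ≤ q ^ j := pow_nonneg hq0 j
    nlinarith
  have h2 : (K + 1) * q ^ n ≤ (K + 1) * (δ / (K + 1)) := mul_le_mul_of_nonneg_left hn.le (by linarith)
  have h3 : (K + 1) * (δ / (K + 1)) = δ := by field_simp
  linarith

/-- **Registered stub `stub_tailL` of crux K1L `LagrangianRenormalisationStep` (skeleton of record v21, line `onelevel`), by name and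
signature.**  The tail step in stream form: beyond `j₂(ε)` every weak solution of the full problem at viscosity `kbar_j` keeps at most `ε‖w₀‖²`
more energy on `(1/2, 1)` than any weak solution of the problem truncated at level `j` — the omitted Lagrangian levels are the divergence of an
antisymmetric stream potential of size `o(kbar_j)` (K3L window distortion `11/10` under the ceiling `θs(k, W)`, word potentials pushed forward,
template bookkeeping), and the energy-class stability under stream-potential perturbations of the carrier closes the estimate.
[cite: ArmstrongVicol2025, §2.2 (PDF p. 18: |ψ_{m,k}| ≤ a_m ε_m² summable; b = lim b_m) and Cor. 2.4 (p. 22)] -/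
theorem stub_tailL : ∀ k (W : Literature.Analysis.FluidPDE.LatticeShear.LatticeWord k), ∃ Λ₁ : ℕ, ∃ θs : ℝ, 0 < θs ∧
    ∀ (E : LatticeShear.LagrangianLatticeCarrier k), E.design = W → E.LPermissible → E.Regular →
    (∀ m, Λ₁ * E.N m ≤ E.N (m + 1)) → (∀ m, E.N m ^ 2 ≤ E.N (m + 1)) →
    (∀ m, E.cellVisc (m + 1) * ((E.N (m + 1) : ℝ) / E.N m) ^ (1 / 4 : ℝ) ≤ 1) →
    ∀ θ₀ : ℝ, θ₀ ≤ θs → (∀ m, E.θ (m + 1) * ((E.N (m + 1) : ℝ) / E.N m) ^ (1 / 16 : ℝ) ≤ θ₀) →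
    ∀ ε : ℝ, 0 < ε → ∃ j₂ : ℕ, ∀ j ≥ j₂, ∀ (w₀ : VF) (w u : ℝ → VF),
      IsDatum w₀ → FullSol E j w₀ w → TSol E j (Torus.isoVisc (E.kbar j)) w₀ u →
        ∀ᵐ t ∂(volume.restrict (Ioo (1/2 : ℝ) 1)), drop w₀ u t ≤ drop w₀ w t + ε * Torus.vectorL2Sq w₀ := by
  intro k W
  obtain ⟨θs, hθs, H⟩ := LagrangianCarrierConstruction.flowDeriv_window_distortion_le k W
  refine ⟨0, θs, hθs, ?_⟩
  intro E hD hLP hReg _hsep hsq hT2 θ₀ hθ₀ hT4 ε hε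
  have hP := hLP.permissible
  have hLag := hLP.isLagrangian
  have hLR := hReg.levelRegular
  obtain ⟨α₀, hα₀, hA⟩ := hLP.amplitude_decay
  have hkpos : (0 : ℝ) < k := by exact_mod_cast W.pos
  have hg := E.toFractalCarrierData.gain_pos
  -- (1) uniform flow-derivative bound on the refresh windows (K3L tower export under the ceiling `θ₀ ≤ θs`)
  have hμ : ∀ (m : ℕ) (j : ℤ), ∀ t ∈ E.window (m + 1) j, ∀ y,
      ‖E.flowDeriv m t ((j : ℝ) * E.refresh (m + 1)) y‖ ≤ 11 / 10 := fun m j t ht y =>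
    (H E θ₀ hD hθ₀ hLP hReg hsq hT4 m j t ht y).2
  -- (2) levelwise stream potentials and sup bounds
  have hlev := fun m t => LagrangianRenormalisationStep.exists_level_stream_potential E m hLag hLR (hμ m) t
  choose ψ hanti hψΛ hψc hdiv using hlev
  have hbB : ∀ m t x, ‖E.b (m + 1) t x‖ ≤ 11 / 10 * (k * E.a (m + 1) / (2 * Real.pi * E.N (m + 1))) := fun m t x =>
    LagrangianRenormalisationStep.norm_b_succ_le_of_flowDeriv_le E m hLag hLR (hμ m) t x
  -- (3) template bookkeeping of the sizes
  obtain ⟨hq0, hq1⟩ := LagrangianRenormalisationStep.quarterRatio_nonneg_lt_one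
  set q : ℝ := (1 / 2 : ℝ) ^ (1 / 4 : ℝ) with hq
  set CB : ℝ := 11 / 10 * (k / (2 * Real.pi)) with hCB
  set CΛ : ℝ := 9 * (11 / 10) ^ 2 * (k / (2 * Real.pi ^ 2)) with hCΛ
  have hCB0 : 0 ≤ CB := by positivity
  have hCΛ0 : 0 ≤ CΛ := by positivity
  have hBsum : Summable fun m => 11 / 10 * (k * E.a (m + 1) / (2 * Real.pi * E.N (m + 1))) := by
    have h := (LagrangianRenormalisationStep.summable_amplitudeScale E.toFractalCarrierData hP hα₀ hA).mul_left CB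
    refine h.congr fun m => ?_
    simp only [hCB]
    ring
  have hΛsum : Summable fun m => 9 * (11 / 10) ^ 2 * (E.a (m + 1) * k / (2 * Real.pi ^ 2 * (E.N (m + 1) : ℝ) ^ 2)) := by
    have h := (LagrangianRenormalisationStep.summable_potentialScale E.toFractalCarrierData hP hT2 hsq).mul_left CΛ
    refine h.congr fun m => ?_
    simp only [hCΛ]
    ring
  have hB0 : ∀ m, 0 ≤ 11 / 10 * (k * E.a (m + 1) / (2 * Real.pi * E.N (m + 1))) := fun m => by
    have := E.toFractalCarrierData.a_pos (m + 1); have := E.toFractalCarrierData.N_pos (m + 1); positivity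
  have hΛ0 : ∀ m, 0 ≤ 9 * (11 / 10) ^ 2 * (E.a (m + 1) * k / (2 * Real.pi ^ 2 * (E.N (m + 1) : ℝ) ^ 2)) := fun m => by
    have := E.toFractalCarrierData.a_pos (m + 1); positivity
  -- the tail size against `kbar j`
  have htail : ∀ j : ℕ, ∑' m, 9 * (11 / 10) ^ 2 * (E.a (m + j + 1) * k / (2 * Real.pi ^ 2 * (E.N (m + j + 1) : ℝ) ^ 2)) ≤
      E.kbar j * (CΛ * (q ^ j / ((1 - q) * E.gain))) := by
    intro j
    have h := LagrangianRenormalisationStep.tsum_potentialScale_tail_le E.toFractalCarrierData hP hT2 hsq j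
    have e : ∀ m, 9 * (11 / 10) ^ 2 * (E.a (m + j + 1) * k / (2 * Real.pi ^ 2 * (E.N (m + j + 1) : ℝ) ^ 2)) =
        CΛ * (E.a (m + j + 1) / (E.N (m + j + 1) : ℝ) ^ 2) := fun m => by
      simp only [hCΛ]; ring
    simp_rw [e]
    rw [tsum_mul_left]
    calc CΛ * ∑' m, E.a (m + j + 1) / (E.N (m + j + 1) : ℝ) ^ 2
        ≤ CΛ * (E.kbar j * (q ^ j / ((1 - q) * E.gain))) := mul_le_mul_of_nonneg_left h hCΛ0
      _ = E.kbar j * (CΛ * (q ^ j / ((1 - q) * E.gain))) := by ring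
  -- (4) the choice of `j₂`: `3 Σ_{m≥j} Λ_m / (2 kbar_j) ≤ K₀ q^j ≤ min 1 (ε/3)`
  set K₀ : ℝ := 3 / 2 * (CΛ / ((1 - q) * E.gain)) with hK₀
  have hK₀0 : 0 ≤ K₀ := by
    have : 0 < 1 - q := by linarith
    positivity
  obtain ⟨j₂, hj₂⟩ := exists_forall_mul_pow_le hq0 hq1 hK₀0 (lt_min one_pos (by positivity : (0:ℝ) < ε / 3))
  refine ⟨j₂, fun j hj w₀ w u hd hw hu => ?_⟩
  -- the datum and the two solutions in the tensor class
  obtain ⟨hH1, hmean, hdiv0⟩ := hd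
  have hw₀ : MemLp w₀ 2 volume := RealisedQuasiStaticCellLaw.memLp_two_of_memSobolev_one_complexify hH1
  have h₁ : Torus.IsWeakTensorPassiveVectorOn 0 1 (Torus.isoVisc (E.kbar j)) E.carrier w₀ w := hw.toTensor
  have h₂ : Torus.IsWeakTensorPassiveVectorOn 0 1 (Torus.isoVisc (E.kbar j)) (E.partialSum j) w₀ u := hu
  -- the truncated carrier is jointly continuous, hence essentially bounded on `(0,1) × 𝕋³`
  have hc : ∀ i < j, Continuous (uncurry (E.b (i + 1))) := fun i _ => hLR.continuous_uncurry_b i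
  have hb' : MemLp (FunctionSpaces.Torus.stLift (E.partialSum j)) ∞
      (volume.restrict (Ioo 0 1 ×ˢ (univ : Set (EuclideanSpace ℝ (Fin 3))))) :=
    LagrangianRenormalisationStep.memLp_top_stLift_of_continuous
      (LagrangianRenormalisationStep.continuous_uncurry_partialSum E j hc) 1
  -- sup bounds of the two carriers
  set M : ℝ := ∑' m, 11 / 10 * (k * E.a (m + 1) / (2 * Real.pi * E.N (m + 1))) with hM
  have hM0 : 0 ≤ M := tsum_nonneg hB0
  have hbM : ∀ᵐ s ∂(volume.restrict (Ioo (0:ℝ) 1)), ∀ᵐ x ∂volume, ‖E.carrier s x‖ ≤ M :=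
    ae_of_all _ fun s => ae_of_all _ fun x => by
      rw [LatticeShear.LagrangianLatticeCarrier.carrier_apply]
      exact Torus.norm_tsum_levels_le (c := fun m x => E.b (m + 1) s x) hBsum (fun m x => hbB m s x) x
  have hbM' : ∀ᵐ s ∂(volume.restrict (Ioo (0:ℝ) 1)), ∀ᵐ x ∂volume, ‖E.partialSum j s x‖ ≤ M :=
    ae_of_all _ fun s => ae_of_all _ fun x => by
      calc ‖E.partialSum j s x‖ = ‖∑ i ∈ Finset.range j, E.b (i + 1) s x‖ := rfl
        _ ≤ ∑ i ∈ Finset.range j, ‖E.b (i + 1) s x‖ := norm_sum_le _ _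
        _ ≤ ∑ i ∈ Finset.range j, 11 / 10 * (k * E.a (i + 1) / (2 * Real.pi * E.N (i + 1))) :=
            Finset.sum_le_sum fun i _ => hbB i s x
        _ ≤ M := Summable.sum_le_tsum _ (fun i _ => hB0 i) hBsum
  -- the stream hypotheses of the tail, from the levelwise data
  obtain ⟨hΨΛ, hΨm, hΨdiv⟩ := Torus.stream_of_levels_tail (T := (1:ℝ)) (b := E.carrier) (b' := E.partialSum j)
    (c := fun m => E.b (m + 1)) (ψ := ψ) hBsum hΛsum j
    (fun s _ x => by rw [LatticeShear.LagrangianLatticeCarrier.carrier_apply]) (fun s _ x => rfl)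
    (fun m s _ x => hbB m s x) (fun m s _ => ((hLR.continuous_uncurry_b m).uncurry_left s).aestronglyMeasurable)
    (fun m s _ x i a => hψΛ m s x i a) (fun m s _ i a => (hψc m s i a).aestronglyMeasurable)
    (fun m s _ φ hφ a => hdiv m s φ hφ a)
  -- the energy-class stability under the stream-potential perturbation of the carrier
  have hmain := Torus.IsWeakTensorPassiveVectorOn.ae_integral_norm_sq_le_add_of_stream h₁ h₂
    (Torus.nearIso_isoVisc (E.kbar j)) (E.kbar_pos j) hw₀ hdiv0 hb' hM0 hM0 hbM hbM'
    (Torus.tsum_potential_antisymm_time (ψ := fun m => ψ (m + j)) (fun m s x i a => hanti (m + j) s x i a))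
    (tsum_nonneg fun m => hΛ0 (m + j)) hΨΛ hΨm hΨdiv
  -- the coefficient is at most `ε`
  set Λt : ℝ := ∑' m, 9 * (11 / 10) ^ 2 * (E.a (m + j + 1) * k / (2 * Real.pi ^ 2 * (E.N (m + j + 1) : ℝ) ^ 2)) with hΛt
  have hΛt0 : 0 ≤ Λt := tsum_nonneg fun m => hΛ0 (m + j)
  have hratio : (Fintype.card (Fin 3) : ℝ) * Λt / (2 * E.kbar j) ≤ min 1 (ε / 3) := by
    have hcard : (Fintype.card (Fin 3) : ℝ) = 3 := by simp
    rw [hcard]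
    have hkb := E.kbar_pos j
    have h1 : 3 * Λt / (2 * E.kbar j) ≤ K₀ * q ^ j := by
      rw [div_le_iff₀ (by positivity)]
      calc 3 * Λt ≤ 3 * (E.kbar j * (CΛ * (q ^ j / ((1 - q) * E.gain)))) := by
            have := htail j; nlinarith
        _ = K₀ * q ^ j * (2 * E.kbar j) := by
            simp only [hK₀]
            have h1q : 0 < 1 - q := by linarith
            have : (1 - q) * E.gain ≠ 0 := by positivity
            field_simp
    exact h1.trans (hj₂ j hj)
  have hcoef := Torus.stream_coeff_le_of_ratio_le_min (D := (Fintype.card (Fin 3) : ℝ)) (Λ := Λt) (lo := E.kbar j) (ε := ε)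
    (by positivity) hΛt0 (E.kbar_pos j) hratio
  -- pass to `(1/2, 1)` and to the drops
  have hsub : Ioo (1/2 : ℝ) 1 ⊆ Ioo (0:ℝ) 1 := Ioo_subset_Ioo (by norm_num) le_rfl
  have hE0 : 0 ≤ Torus.vectorL2Sq w₀ := integral_nonneg fun x => by positivity
  filter_upwards [ae_restrict_of_ae_restrict_of_subset hsub hmain] with t ht
  have e : Torus.vectorL2Sq w₀ = ∫ x, ‖w₀ x‖ ^ 2 := rfl
  unfold drop
  rw [← e] at ht
  nlinarith [ht, mul_le_mul_of_nonneg_right hcoef hE0]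

end Summit.AnomalousDissipation.AnomalousDissipation.Theorems.SolenoidalFractalHomogenisation.LagrangianStep

end
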